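import Literature.Probability.RandomPlanarGeometry.HexSAWSurfaceWallRenewalCensusEngineFast
import HarnessLib

/-!
# The ORDER-FOURTEEN diagonal census of the adsorbed honeycomb walk: class `(17,3)`, leaf module 14 of 14 (2 kernel leaves, `80540` search nodes)

Topic `Literature/Probability/RandomPlanarGeometry` (lane «pcv-sawmu», a-p6 g23; parent: «CENSUS-ENGINE-FAST» (`HexSAWSurfaceWallRenewalCensusEngineFast`, #910:
★ `WFast.card_filter_visits_ipwb_eq_fcount`, the one-level split `WFast.cntS_succ` and the child list `WFast.kidsF`)).  `N_{s,v} = #{ω ∈ ipwb (2s) : visits = v}` are the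
class numbers of the wall-renewal census (irreducible positive wall bridges of the adsorbing honeycomb walk by half-length and surface visits); the diagonal `s − v = 14`
decides the FOURTEENTH coefficient `a₁₃` of `β(y)² = y + Σ a_k y^{−k}` through Kesten's identity (classes `(15,1) … (21,7)`; `N_{21,7} = 1` is CAR 73).
ADAPTIVE CERTIFICATE: the `(34, 3)` search tree (`3905128` nodes) is cut at every state whose subtree has at most `60000` nodes — 111 LEAVES, each ONE
`decide +kernel` evaluation of the scalar count `WFast.cntS` at an explicit state `(x, d, mask, n, v, mx, pm, nd)` — and the 124 states above the cut are
assembled in the class's assembly module by `WFast.cntS_succ` (one `kidsF` evaluation each).  This module: leaves 109 … 110 (partial count `499`), each under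
`set_option maxHeartbeats 4000000 in` (2 budget lines, nothing else budgeted).  Data (replica of the fast engine, a-p6 g23): diagonal 14 = `51018 / 70726 / 55092 / 28622 / 8045 / 649 / 1`, sum `214153`.
NOT claimed here: the class number (assembly module), `a₁₃`.  Label (lane): LANE CENSUS (kernel, by the verified fast engine).  Sources: [MadrasSlade1993, Section 4.2,
Definition 4.2.1, (4.2.2)], [Kesten1963SAW, Section 4], [EntingJensen2009, Section 7.4.2, Fig. 7.10], [BeatonBousquetMelouDeGierDuminilCopinGuttmann2014, Section 3.1 (arXiv v5 p. 8)].
-/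

namespace Literature.Probability.RandomPlanarGeometry.SAW.HexBW.Wall

open WFast

set_option maxHeartbeats 4000000 in
/-- Kernel leaf `rvrvlvrvrv` of the `(34, 3)` search: the scalar count with `24` steps to go below this state (`49298` nodes). [cite: MadrasSlade1993, Section 4.2, Definition 4.2.1, (4.2.2)] -/
theorem cntS_thirtyfour_three_rvrvlvrvrv : cntS 3 35 34 24 (3, 5, 1947111321985978109320973858635777, 10, 0, 3, 0, 5) = 329 := by
  decide +kernel

set_option maxHeartbeats 4000000 in
/-- Kernel leaf `rvrvlvrvl` of the `(34, 3)` search: the scalar count with `25` steps to go below this state (`31242` nodes). [cite: MadrasSlade1993, Section 4.2, Definition 4.2.1, (4.2.2)] -/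
theorem cntS_thirtyfour_three_rvrvlvrvl : cntS 3 35 34 25 (1, 4, 35417748622587490992129, 9, 0, 2, 0, 4) = 170 := by
  decide +kernel

end Literature.Probability.RandomPlanarGeometry.SAW.HexBW.Wall
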